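import Summits.QuantumFields.BalabanUV.Beta.D1BFx.NeedleGhostBubblePointwise

/-!
# `BalabanUV.Beta.D1BFx.NeedleGhostBubble2Pointwise` — road «BF-x», binder row D1, slot (K), END row `hGrp gN`, (N-2) «NT-6 POINTWISE»:
# **THE TWO-NEEDLE GHOST BUBBLE `qA ⊗ qA` IN CLOSED FORM AND ITS FOUR-PLACEMENT BOUND** (owner FINDING U-1: the diagonal placements are SIGNED block
# sums of the legs, the mixed placements take one sup — every leg letter ABSTRACT here; the consumer plugs `gq ≤ cG·e^{−δD}`, `|Ggh| ≤ S·e^{−δ dist∕n}`)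

HONEST DEPENDENCY (cell records, verbatim): «continuum YM on T⁴ ⇐ BetaPertH ∧ nine spine estimates (0/9 proved); BetaPertH ⇐ (D1) ∧ (D4) ∧
CAP+tail; G-an2-4 gates asym, D1 and NE2/3/4.»  HONEST FRAMING (cell contract, verbatim): «discharging `BetaPertH` makes Bałaban's UV stability
UNCONDITIONAL — a real constructive-QFT result; it is NOT the continuum limit and NOT the Clay problem.»  THIS MODULE DISCHARGES NOTHING of the wall:
[folklore] FINITE bookkeeping BY NAME over gan24-leaf-05-g41's `NeedleGhostBubblePointwise` (p257330: `comp_qAntiAt_apply`, `comp_qAntiAt_eq_zero_of_not_mem`)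
and M1 `GhostNeedleRootedLetters.abs_qJetAt_le_inv_pow_four` (p256404); holds for ANY two legs `A K : MKer 4 Unit` (no decay, no symmetry, no `Spr`).
No `def`, no `def … : Prop`, nothing cited, 0 sorry.  0 wall binders (root-level hW ∕ hR-sockets ∕ hSX-socket ∕ D1Tel ∕ D1Rep — 0); (K) NOT closed; NOT D1, NOT
`BetaPertH`, NOT continuum, NOT Clay.

ABSOLUTE RULE (cell charter, verbatim): «No internally-minted statement may enter as a cited fact. Every hypothesis is either kernel-proved in this
package or a verbatim quotation of a PUBLISHED theorem with page reference. The manuscript(s) under audit are NOT citable for their own disputed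
steps — they are the thing under adjudication; programme-internal (2001/route/tribunal) claims are never citable.»

CONTENT (with `B := B(blk u)`, `B′ := B(blk u′)`, `g := qJetAt ρ n κ u (blk u)`, `g′ := qJetAt ρ n λ u′ (blk u′)`, `R y := Σ_{t∈B} A y t`, `ρ y := Σ_{t∈B} A y t·g t`,
`R′ y := Σ_{t∈B′} K y t`, `ρ′ y := Σ_{t∈B′} K y t·g′ t`).
* §1 [folklore] **`biBubble_qAntiAt_qAntiAt`**: `biBubble A (qAntiAt ρ n κ u) K (qAntiAt ρ n λ u′) = (Σ_{x∈B′} R x·g′ x)(Σ_{z∈B} g z·R′ z) − (Σ_{x∈B′} R x)(Σ_{z∈B} g z·ρ′ z)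
  − (Σ_{x∈B′} ρ x·g′ x)(Σ_{z∈B} R′ z) + (Σ_{x∈B′} ρ x)(Σ_{z∈B} ρ′ z)` — all sums FINITE.
* §2 [folklore] **`abs_biBubble_qAntiAt_qAntiAt_le`** — the FOUR-PLACEMENT BOUND with abstract leg letters: block row sums of `A` over `B` seen from `B′` bounded by `RA`
  (`|R x| ≤ RA` for `x ∈ B′`), block row sums of `K` over `B′` seen from `B` by `RK`, the signed sums `Σ_{x∈B′} ρ x`, `Σ_{z∈B} ρ′ z` through the COLUMN sums (`|Σ_{x∈B′} A x t| ≤ CA` for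
  `t ∈ B`, `|Σ_{z∈B} K z t| ≤ CK` for `t ∈ B′`), the mixed entries by sups `SA`, `SK` (`|A x t|`, `x ∈ B′`, `t ∈ B`; `|K z t|`, `z ∈ B`, `t ∈ B′`):
  `|biBubble| ≤ (RA·RK + n⁴·RA·SK + n⁴·SA·RK + CA·CK)·(Σ_{z∈B}|g z|)·(Σ_{x∈B′}|g′ x|)`.
Unit `b2b-balaban-beta-d1-p2` (gen 9), road «BF-x» OWNER; written as the pointwise half of «NT-6» (first refusal of the row: gan24-leaf-05-g41).
-/

noncomputable section

namespace Summit.QuantumFields.BalabanUV.Beta.D1BFx.NeedleGhostBubble2Pointwise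

open Finset
open scoped BigOperators
open Literature.MathematicalPhysics.QuantumFieldTheory.Balaban1983to89
open Literature.MathematicalPhysics.QuantumFieldTheory.Balaban1983to89.Beta
open B6QGQLower276 (blk B mem_B)
open ExpKernelCalculus (Site MKer comp tr)
open Summit.QuantumFields.BalabanUV.Beta.D1BFx.PackedKernelSplit (biBubble)
open Summit.QuantumFields.BalabanUV.Beta.D1BFx.GhostStencilRooted (qJetAt qAntiAt)
open Summit.QuantumFields.BalabanUV.Beta.D1BFx.GhostNeedleRootedLetters (abs_qJetAt_le_inv_pow_four sum_B_const')
open Summit.QuantumFields.BalabanUV.Beta.D1BFx.NeedleGhostBubblePointwise (comp_qAntiAt_apply comp_qAntiAt_eq_zero_of_not_mem)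

variable (ρ : Site 4) (n : ℕ) (κ : Fin 4) (u : Site 4) (lam : Fin 4) (u' : Site 4) (A K : MKer 4 Unit)

/-! ## §1 The closed form -/

/-- [folklore] **CLOSED FORM OF `qA ⊗ qA`** (ANY two legs; all sums finite): with the notation of the header,
`biBubble A (qAntiAt ρ n κ u) K (qAntiAt ρ n λ u′) = (Σ_{x∈B′} R x·g′ x)(Σ_{z∈B} g z·R′ z) − (Σ_{x∈B′} R x)(Σ_{z∈B} g z·ρ′ z) − (Σ_{x∈B′} ρ x·g′ x)(Σ_{z∈B} R′ z)
 + (Σ_{x∈B′} ρ x)(Σ_{z∈B} ρ′ z)`. -/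
theorem biBubble_qAntiAt_qAntiAt :
    biBubble A (qAntiAt ρ n κ u) K (qAntiAt ρ n lam u') =
      (∑ x ∈ B (n - 1) (blk (n - 1) u'), (∑ t ∈ B (n - 1) (blk (n - 1) u), A x t () ()) * qJetAt ρ n lam u' (blk (n - 1) u') x) *
          (∑ z ∈ B (n - 1) (blk (n - 1) u), qJetAt ρ n κ u (blk (n - 1) u) z * ∑ t ∈ B (n - 1) (blk (n - 1) u'), K z t () ())
        - (∑ x ∈ B (n - 1) (blk (n - 1) u'), ∑ t ∈ B (n - 1) (blk (n - 1) u), A x t () ()) *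
          (∑ z ∈ B (n - 1) (blk (n - 1) u), qJetAt ρ n κ u (blk (n - 1) u) z *
            ∑ t ∈ B (n - 1) (blk (n - 1) u'), K z t () () * qJetAt ρ n lam u' (blk (n - 1) u') t)
        - (∑ x ∈ B (n - 1) (blk (n - 1) u'), (∑ t ∈ B (n - 1) (blk (n - 1) u), A x t () () * qJetAt ρ n κ u (blk (n - 1) u) t) *
            qJetAt ρ n lam u' (blk (n - 1) u') x) *
          (∑ z ∈ B (n - 1) (blk (n - 1) u), ∑ t ∈ B (n - 1) (blk (n - 1) u'), K z t () ())
        + (∑ x ∈ B (n - 1) (blk (n - 1) u'), ∑ t ∈ B (n - 1) (blk (n - 1) u), A x t () () * qJetAt ρ n κ u (blk (n - 1) u) t) *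
          (∑ z ∈ B (n - 1) (blk (n - 1) u), ∑ t ∈ B (n - 1) (blk (n - 1) u'), K z t () () * qJetAt ρ n lam u' (blk (n - 1) u') t) := by
  classical
  unfold biBubble tr
  simp only [Finset.univ_unique, PUnit.default_eq_unit, Finset.sum_singleton]
  have hdiag : ∀ x : Site 4, comp (comp A (qAntiAt ρ n κ u)) (comp K (qAntiAt ρ n lam u')) x x () () =
      ∑ z ∈ B (n - 1) (blk (n - 1) u), comp A (qAntiAt ρ n κ u) x z () () * comp K (qAntiAt ρ n lam u') z x () () := by
    intro x
    rw [show comp (comp A (qAntiAt ρ n κ u)) (comp K (qAntiAt ρ n lam u')) x x () () =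
      ∑' z, ∑ f : Unit, comp A (qAntiAt ρ n κ u) x z () f * comp K (qAntiAt ρ n lam u') z x f () from rfl]
    simp only [Finset.univ_unique, PUnit.default_eq_unit, Finset.sum_singleton]
    exact tsum_eq_sum (s := B (n - 1) (blk (n - 1) u)) fun z hz => by
      rw [comp_qAntiAt_eq_zero_of_not_mem ρ n κ u A x () () hz, zero_mul]
  simp only [hdiag]
  rw [tsum_eq_sum (s := B (n - 1) (blk (n - 1) u')) (fun x hx => Finset.sum_eq_zero fun z _ => by
      rw [comp_qAntiAt_eq_zero_of_not_mem ρ n lam u' K z () () hx, mul_zero])]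
  have e : ∀ x ∈ B (n - 1) (blk (n - 1) u'), ∀ z ∈ B (n - 1) (blk (n - 1) u),
      comp A (qAntiAt ρ n κ u) x z () () * comp K (qAntiAt ρ n lam u') z x () () =
        ((∑ t ∈ B (n - 1) (blk (n - 1) u), A x t () ()) * qJetAt ρ n lam u' (blk (n - 1) u') x) *
            (qJetAt ρ n κ u (blk (n - 1) u) z * ∑ t ∈ B (n - 1) (blk (n - 1) u'), K z t () ())
          - (∑ t ∈ B (n - 1) (blk (n - 1) u), A x t () ()) *
            (qJetAt ρ n κ u (blk (n - 1) u) z * ∑ t ∈ B (n - 1) (blk (n - 1) u'), K z t () () * qJetAt ρ n lam u' (blk (n - 1) u') t)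
          - ((∑ t ∈ B (n - 1) (blk (n - 1) u), A x t () () * qJetAt ρ n κ u (blk (n - 1) u) t) * qJetAt ρ n lam u' (blk (n - 1) u') x) *
            (∑ t ∈ B (n - 1) (blk (n - 1) u'), K z t () ())
          + (∑ t ∈ B (n - 1) (blk (n - 1) u), A x t () () * qJetAt ρ n κ u (blk (n - 1) u) t) *
            (∑ t ∈ B (n - 1) (blk (n - 1) u'), K z t () () * qJetAt ρ n lam u' (blk (n - 1) u') t) := by
    intro x hx z hz
    rw [comp_qAntiAt_apply, comp_qAntiAt_apply, if_pos (mem_B.1 hz), if_pos (mem_B.1 hx)]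
    ring
  rw [Finset.sum_congr rfl fun x hx => Finset.sum_congr rfl fun z hz => e x hx z hz]
  simp only [Finset.sum_add_distrib, Finset.sum_sub_distrib, ← Finset.sum_mul_sum]

/-! ## §2 The four-placement bound with abstract leg letters -/

/-- [folklore] **THE FOUR-PLACEMENT BOUND** (U-1): if `|Σ_{t∈B} A x t| ≤ RA` for `x ∈ B′`, `|Σ_{t∈B′} K z t| ≤ RK` for `z ∈ B`, the COLUMN sums `|Σ_{x∈B′} A x t| ≤ CA` (`t ∈ B`),
`|Σ_{z∈B} K z t| ≤ CK` (`t ∈ B′`), and the entries `|A x t| ≤ SA` (`x ∈ B′`, `t ∈ B`), `|K z t| ≤ SK` (`z ∈ B`, `t ∈ B′`), `RA, SA ≥ 0`, then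
`|biBubble A (qAntiAt ρ n κ u) K (qAntiAt ρ n λ u′)| ≤ (RA·RK + n⁴·RA·SK + n⁴·SA·RK + CA·CK)·(Σ_{z∈B}|g z|)·(Σ_{x∈B′}|g′ x|)`. -/
theorem abs_biBubble_qAntiAt_qAntiAt_le [NeZero n] {RA RK CA CK SA SK : ℝ} (hRA0 : 0 ≤ RA) (hSA0 : 0 ≤ SA)
    (hRA : ∀ x ∈ B (n - 1) (blk (n - 1) u'), |∑ t ∈ B (n - 1) (blk (n - 1) u), A x t () ()| ≤ RA)
    (hRK : ∀ z ∈ B (n - 1) (blk (n - 1) u), |∑ t ∈ B (n - 1) (blk (n - 1) u'), K z t () ()| ≤ RK)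
    (hCA : ∀ t ∈ B (n - 1) (blk (n - 1) u), |∑ x ∈ B (n - 1) (blk (n - 1) u'), A x t () ()| ≤ CA)
    (hCK : ∀ t ∈ B (n - 1) (blk (n - 1) u'), |∑ z ∈ B (n - 1) (blk (n - 1) u), K z t () ()| ≤ CK)
    (hSA : ∀ x ∈ B (n - 1) (blk (n - 1) u'), ∀ t ∈ B (n - 1) (blk (n - 1) u), |A x t () ()| ≤ SA)
    (hSK : ∀ z ∈ B (n - 1) (blk (n - 1) u), ∀ t ∈ B (n - 1) (blk (n - 1) u'), |K z t () ()| ≤ SK) :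
    |biBubble A (qAntiAt ρ n κ u) K (qAntiAt ρ n lam u')| ≤
      (RA * RK + (n : ℝ) ^ 4 * RA * SK + (n : ℝ) ^ 4 * SA * RK + CA * CK) *
        ((∑ z ∈ B (n - 1) (blk (n - 1) u), |qJetAt ρ n κ u (blk (n - 1) u) z|) *
         (∑ x ∈ B (n - 1) (blk (n - 1) u'), |qJetAt ρ n lam u' (blk (n - 1) u') x|)) := by
  classical
  set Y := blk (n - 1) u with hY
  set Y' := blk (n - 1) u' with hY'
  set g : Site 4 → ℝ := fun t => qJetAt ρ n κ u Y t with hg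
  set g' : Site 4 → ℝ := fun t => qJetAt ρ n lam u' Y' t with hg'
  set G₁ : ℝ := ∑ z ∈ B (n - 1) Y, |g z| with hG₁
  set G₁' : ℝ := ∑ x ∈ B (n - 1) Y', |g' x| with hG₁'
  have hG0 : 0 ≤ G₁ := Finset.sum_nonneg fun _ _ => abs_nonneg _
  have hG0' : 0 ≤ G₁' := Finset.sum_nonneg fun _ _ => abs_nonneg _
  rw [biBubble_qAntiAt_qAntiAt]
  -- T1: `(Σ_{x∈B′} R x·g′ x)(Σ_{z∈B} g z·R′ z)`
  have hT1a : |∑ x ∈ B (n - 1) Y', (∑ t ∈ B (n - 1) Y, A x t () ()) * g' x| ≤ RA * G₁' := by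
    rw [hG₁', Finset.mul_sum]
    refine (Finset.abs_sum_le_sum_abs _ _).trans (Finset.sum_le_sum fun x hx => ?_)
    rw [abs_mul]; exact mul_le_mul_of_nonneg_right (hRA x hx) (abs_nonneg _)
  have hT1b : |∑ z ∈ B (n - 1) Y, g z * ∑ t ∈ B (n - 1) Y', K z t () ()| ≤ G₁ * RK := by
    rw [hG₁, Finset.sum_mul]
    refine (Finset.abs_sum_le_sum_abs _ _).trans (Finset.sum_le_sum fun z hz => ?_)
    rw [abs_mul]; exact mul_le_mul_of_nonneg_left (hRK z hz) (abs_nonneg _)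
  -- T2: `(Σ_{x∈B′} R x)(Σ_{z∈B} g z·ρ′ z)`, `|ρ′ z| ≤ SK·G₁′`
  have hT2a : |∑ x ∈ B (n - 1) Y', ∑ t ∈ B (n - 1) Y, A x t () ()| ≤ (n : ℝ) ^ 4 * RA := by
    refine (Finset.abs_sum_le_sum_abs _ _).trans ?_
    calc ∑ x ∈ B (n - 1) Y', |∑ t ∈ B (n - 1) Y, A x t () ()| ≤ ∑ _x ∈ B (n - 1) Y', RA := Finset.sum_le_sum hRA
      _ = (n : ℝ) ^ 4 * RA := sum_B_const' n Y' RA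
  have hρK : ∀ z ∈ B (n - 1) Y, |∑ t ∈ B (n - 1) Y', K z t () () * g' t| ≤ SK * G₁' := by
    intro z hz
    rw [hG₁', Finset.mul_sum]
    refine (Finset.abs_sum_le_sum_abs _ _).trans (Finset.sum_le_sum fun t ht => ?_)
    rw [abs_mul]; exact mul_le_mul_of_nonneg_right (hSK z hz t ht) (abs_nonneg _)
  have hT2b : |∑ z ∈ B (n - 1) Y, g z * ∑ t ∈ B (n - 1) Y', K z t () () * g' t| ≤ G₁ * (SK * G₁') := by
    rw [hG₁, Finset.sum_mul]
    refine (Finset.abs_sum_le_sum_abs _ _).trans (Finset.sum_le_sum fun z hz => ?_)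
    rw [abs_mul]; exact mul_le_mul_of_nonneg_left (hρK z hz) (abs_nonneg _)
  -- T3: `(Σ_{x∈B′} ρ x·g′ x)(Σ_{z∈B} R′ z)`, `|ρ x| ≤ SA·G₁`
  have hρA : ∀ x ∈ B (n - 1) Y', |∑ t ∈ B (n - 1) Y, A x t () () * g t| ≤ SA * G₁ := by
    intro x hx
    rw [hG₁, Finset.mul_sum]
    refine (Finset.abs_sum_le_sum_abs _ _).trans (Finset.sum_le_sum fun t ht => ?_)
    rw [abs_mul]; exact mul_le_mul_of_nonneg_right (hSA x hx t ht) (abs_nonneg _)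
  have hT3a : |∑ x ∈ B (n - 1) Y', (∑ t ∈ B (n - 1) Y, A x t () () * g t) * g' x| ≤ SA * G₁ * G₁' := by
    rw [hG₁', Finset.mul_sum]
    refine (Finset.abs_sum_le_sum_abs _ _).trans (Finset.sum_le_sum fun x hx => ?_)
    rw [abs_mul]; exact mul_le_mul_of_nonneg_right (hρA x hx) (abs_nonneg _)
  have hT3b : |∑ z ∈ B (n - 1) Y, ∑ t ∈ B (n - 1) Y', K z t () ()| ≤ (n : ℝ) ^ 4 * RK := by
    refine (Finset.abs_sum_le_sum_abs _ _).trans ?_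
    calc ∑ z ∈ B (n - 1) Y, |∑ t ∈ B (n - 1) Y', K z t () ()| ≤ ∑ _z ∈ B (n - 1) Y, RK := Finset.sum_le_sum hRK
      _ = (n : ℝ) ^ 4 * RK := sum_B_const' n Y RK
  -- T4: the SIGNED sums through the column sums: `Σ_{x∈B′} ρ x = Σ_{t∈B} g t·(Σ_{x∈B′} A x t)`
  have hT4a : |∑ x ∈ B (n - 1) Y', ∑ t ∈ B (n - 1) Y, A x t () () * g t| ≤ CA * G₁ := by
    rw [Finset.sum_comm]
    have e : ∀ t ∈ B (n - 1) Y, ∑ x ∈ B (n - 1) Y', A x t () () * g t = (∑ x ∈ B (n - 1) Y', A x t () ()) * g t := fun t _ => by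
      rw [Finset.sum_mul]
    rw [Finset.sum_congr rfl e, hG₁, Finset.mul_sum]
    refine (Finset.abs_sum_le_sum_abs _ _).trans (Finset.sum_le_sum fun t ht => ?_)
    rw [abs_mul]; exact mul_le_mul_of_nonneg_right (hCA t ht) (abs_nonneg _)
  have hT4b : |∑ z ∈ B (n - 1) Y, ∑ t ∈ B (n - 1) Y', K z t () () * g' t| ≤ CK * G₁' := by
    rw [Finset.sum_comm]
    have e : ∀ t ∈ B (n - 1) Y', ∑ z ∈ B (n - 1) Y, K z t () () * g' t = (∑ z ∈ B (n - 1) Y, K z t () ()) * g' t := fun t _ => by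
      rw [Finset.sum_mul]
    rw [Finset.sum_congr rfl e, hG₁', Finset.mul_sum]
    refine (Finset.abs_sum_le_sum_abs _ _).trans (Finset.sum_le_sum fun t ht => ?_)
    rw [abs_mul]; exact mul_le_mul_of_nonneg_right (hCK t ht) (abs_nonneg _)
  -- assemble
  have hCA0 : 0 ≤ CA := (abs_nonneg _).trans (hCA u (mem_B.2 rfl))
  have hCK0 : 0 ≤ CK := (abs_nonneg _).trans (hCK u' (mem_B.2 rfl))
  have h4 : ∀ p q r s : ℝ, |p - q - r + s| ≤ |p| + |q| + |r| + |s| := fun p q r s => by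
    have h1 := abs_add_le (p - q - r) s; have h2 := abs_sub (p - q) r; have h3 := abs_sub p q; linarith
  refine (h4 _ _ _ _).trans ?_
  rw [abs_mul, abs_mul, abs_mul, abs_mul]
  have hn4 : (0 : ℝ) ≤ (n : ℝ) ^ 4 := pow_nonneg (Nat.cast_nonneg n) 4
  calc |∑ x ∈ B (n - 1) Y', (∑ t ∈ B (n - 1) Y, A x t () ()) * g' x| * |∑ z ∈ B (n - 1) Y, g z * ∑ t ∈ B (n - 1) Y', K z t () ()|
        + |∑ x ∈ B (n - 1) Y', ∑ t ∈ B (n - 1) Y, A x t () ()| * |∑ z ∈ B (n - 1) Y, g z * ∑ t ∈ B (n - 1) Y', K z t () () * g' t|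
        + |∑ x ∈ B (n - 1) Y', (∑ t ∈ B (n - 1) Y, A x t () () * g t) * g' x| * |∑ z ∈ B (n - 1) Y, ∑ t ∈ B (n - 1) Y', K z t () ()|
        + |∑ x ∈ B (n - 1) Y', ∑ t ∈ B (n - 1) Y, A x t () () * g t| * |∑ z ∈ B (n - 1) Y, ∑ t ∈ B (n - 1) Y', K z t () () * g' t|
      ≤ (RA * G₁') * (G₁ * RK) + ((n : ℝ) ^ 4 * RA) * (G₁ * (SK * G₁')) + (SA * G₁ * G₁') * ((n : ℝ) ^ 4 * RK) + (CA * G₁) * (CK * G₁') :=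
        add_le_add (add_le_add (add_le_add
          (mul_le_mul hT1a hT1b (abs_nonneg _) (mul_nonneg hRA0 hG0'))
          (mul_le_mul hT2a hT2b (abs_nonneg _) (mul_nonneg hn4 hRA0)))
          (mul_le_mul hT3a hT3b (abs_nonneg _) (mul_nonneg (mul_nonneg hSA0 hG0) hG0')))
          (mul_le_mul hT4a hT4b (abs_nonneg _) (mul_nonneg hCA0 hG0))
    _ = (RA * RK + (n : ℝ) ^ 4 * RA * SK + (n : ℝ) ^ 4 * SA * RK + CA * CK) * (G₁ * G₁') := by ring

end Summit.QuantumFields.BalabanUV.Beta.D1BFx.NeedleGhostBubble2Pointwise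

end
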